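import Literature.Probability.RandomPlanarGeometry.KlebanZagierTheorem2

/-!
# Stub `stub_lamRLog` (B) of line `two-cluster-rate-is-stationary-gap`
# (crux `CardyBoundaryCoulombGas.StripClusterRates`, stmt-CriticalPhenomena-13878)

**B · `log λ(it) / t → -π`** as `t → ∞`, for the elliptic modulus on the imaginary axis
`λ(it) = θ₂(it)⁴/θ₃(it)⁴` (`KlebanZagier.lamR`; classically `λ(it) = 16 e^{-πt}(1 + O(e^{-πt}))`).
This is the source of the constant `π` in the Cardy-order evaluation `n·γ₁(n) → π/3` of the strip
crossing rate: the corner-marked rectangle of aspect `A` has cross-ratio `λ(iA)`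
(`rectangle_crossRatio_eq_lamR`), and `log F(η)/log η → 1/3` (stub C).

Proof. On `(0, ∞)` the function `g(t) := log λ(it) + πt` has derivative
`g'(t) = π (1 - θ₄(it)⁴)` (`KlebanZagier.hasDerivAt_lamR`: `(d/dt) λ(it) = -π λ(it) θ₄(it)⁴`, and
`λ(it) > 0`, `KlebanZagier.lamR_mem_Ioo`), and `θ₄(it) → 1` (`isBigOqhat_theta4`), so `g' → 0`.
By the mean value inequality `|g(t) - g(T₀)| ≤ ε (t - T₀)` for `t ≥ T₀`, whence `g(t)/t → 0` and
`log λ(it)/t = g(t)/t - π → -π`.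
-/

noncomputable section

namespace Summit.CriticalPhenomena.CardyFormulaZ2.Cruxes.StripClusterRates.TwoClusterRateIsStationaryGap

open Filter Topology
open Literature.Probability.RandomPlanarGeometry.KlebanZagier
open Literature.NumberTheory.EllipticCurves.JacobiThetaNull

/-- `θ₄(it) → 1` as `t → ∞` along the positive imaginary axis (real parts), from
`θ₄ = 1 + O(e^{-π Im τ})`. [folklore] -/
theorem lamRLog_tendsto_theta4_re :
    Tendsto (fun t : ℝ => (theta4 (Complex.I * t)).re) atTop (𝓝 1) := by
  have hθ4 := isBigOqhat_theta4.tendsto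
  have hax : Tendsto (fun t : ℝ => (Complex.I * t : ℂ)) atTop (comap Complex.im atTop) := by
    refine tendsto_comap_iff.mpr ?_
    have : (Complex.im ∘ fun t : ℝ => (Complex.I * t : ℂ)) = id := by funext t; simp
    rw [this]
    exact tendsto_id
  have h := (Complex.continuous_re.tendsto 1).comp (hθ4.comp hax)
  rw [Complex.one_re] at h
  exact h

/-- If `g` has derivative `g'` on `(a, ∞)` and `g' → 0` at `∞`, then `g(t)/t → 0` at `∞`
(mean value inequality). [folklore] -/
theorem lamRLog_tendsto_div_self_of_hasDerivAt {g g' : ℝ → ℝ} {a : ℝ}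
    (hg : ∀ t, a < t → HasDerivAt g (g' t) t) (hg' : Tendsto g' atTop (𝓝 0)) :
    Tendsto (fun t => g t / t) atTop (𝓝 0) := by
  rw [Metric.tendsto_atTop]
  intro ε hε
  have hε2 : 0 < ε / 2 := by positivity
  have hev : ∀ᶠ t in atTop, |g' t| ≤ ε / 2 := by
    have h := (Metric.tendsto_nhds.mp hg') (ε / 2) hε2
    filter_upwards [h] with t ht
    rw [Real.dist_eq, sub_zero] at ht
    exact ht.le
  obtain ⟨T₀, hT₀⟩ := eventually_atTop.mp
    (hev.and ((eventually_gt_atTop a).and (eventually_gt_atTop 0)))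
  have hT₀a : a < T₀ := (hT₀ T₀ le_rfl).2.1
  have hT₀pos : 0 < T₀ := (hT₀ T₀ le_rfl).2.2
  -- the mean value inequality on `[T₀, ∞)`
  have hmvt : ∀ t, T₀ ≤ t → ‖g t - g T₀‖ ≤ ε / 2 * ‖t - T₀‖ := by
    intro t ht
    refine (convex_Ici T₀).norm_image_sub_le_of_norm_hasDerivWithin_le (f := g) (f' := g')
      (fun x hx => (hg x (lt_of_lt_of_le hT₀a hx)).hasDerivWithinAt)
      (fun x hx => ?_) Set.self_mem_Ici ht
    rw [Real.norm_eq_abs]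
    exact (hT₀ x hx).1
  refine ⟨max T₀ (2 * |g T₀| / ε + 1), fun t ht => ?_⟩
  have htT : T₀ ≤ t := le_trans (le_max_left _ _) ht
  have ht2 : 2 * |g T₀| / ε + 1 ≤ t := le_trans (le_max_right _ _) ht
  have htpos : 0 < t := lt_of_lt_of_le hT₀pos htT
  have h3 : |g T₀| < ε / 2 * t := by
    have h4 : 2 * |g T₀| / ε < t := by linarith
    rw [div_lt_iff₀ hε] at h4
    linarith
  have h1 := hmvt t htT
  rw [Real.norm_eq_abs, Real.norm_eq_abs, abs_of_nonneg (sub_nonneg.mpr htT), abs_le] at h1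
  rw [Real.dist_eq, sub_zero, abs_div, abs_of_pos htpos, div_lt_iff₀ htpos, abs_lt]
  obtain ⟨h1l, h1r⟩ := h1
  have h5 := le_abs_self (g T₀)
  have h6 := neg_abs_le (g T₀)
  constructor
  · nlinarith
  · nlinarith

/-- **B — `stub_lamRLog`.** `log λ(it) / t → -π` as `t → ∞`, where `λ(it) = θ₂(it)⁴/θ₃(it)⁴`
(`KlebanZagier.lamR`). From `(log λ(it))' = -π θ₄(it)⁴ → -π` and the mean value inequality.
[cite: KlebanZagier2003, §3] -/
theorem stub_lamRLog :
    Tendsto (fun t : ℝ ↦ Real.log (Literature.Probability.RandomPlanarGeometry.KlebanZagier.lamR t) / t)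
      atTop (𝓝 (-Real.pi)) := by
  have hderiv : ∀ t : ℝ, 0 < t →
      HasDerivAt (fun s : ℝ => Real.log (lamR s) + Real.pi * s)
        (Real.pi * (1 - (theta4 (Complex.I * t)).re ^ 4)) t := by
    intro t ht
    have hl := lamR_mem_Ioo ht
    have h1 := (hasDerivAt_lamR ht).log hl.1.ne'
    have h2 := h1.fun_add ((hasDerivAt_id t).const_mul Real.pi)
    have hl0 : lamR t ≠ 0 := hl.1.ne'
    refine h2.congr_deriv ?_
    field_simp
    ring
  have hg' : Tendsto (fun t : ℝ => Real.pi * (1 - (theta4 (Complex.I * t)).re ^ 4)) atTop (𝓝 0) := by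
    have h := lamRLog_tendsto_theta4_re
    have h' : Tendsto (fun t : ℝ => Real.pi * (1 - (theta4 (Complex.I * t)).re ^ 4)) atTop
        (𝓝 (Real.pi * (1 - 1 ^ 4))) :=
      (tendsto_const_nhds.sub (h.pow 4)).const_mul Real.pi
    simpa using h'
  have hlim := lamRLog_tendsto_div_self_of_hasDerivAt hderiv hg'
  have h := hlim.sub_const Real.pi
  rw [zero_sub] at h
  refine h.congr' ?_
  filter_upwards [eventually_gt_atTop (0 : ℝ)] with t ht
  field_simp
  ring

end Summit.CriticalPhenomena.CardyFormulaZ2.Cruxes.StripClusterRates.TwoClusterRateIsStationaryGap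

end
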